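import Mathlib
import Summits.NavierStokesRegularity.NavierStokesRegularity.Theorems.EulerZoomLiouvillePowerGaugeEulerLiouvilleNeedleCauchyLocal
import Summits.NavierStokesRegularity.NavierStokesRegularity.Theorems.EulerZoomLiouvillePowerGaugeEulerLiouvilleSelfSimilarBernoulliLandscape
import HarnessLib

/-!
# Crux `EulerZoomLiouville.PowerGaugeEulerLiouville` (stmt-NavierStokesRegularity-19832): KELVIN'S PINCH, part 1 — the transport identity (plate t60-PINCH of nsreg-p2 ROUND-55)

Width/portrait piece for THE ONE STATEMENT `stub_selfSimilarC2Needle` (LEAD skeleton `Cruxes/PowerGaugeEulerLiouville/Lines/birth.lean`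
v112, ns-typeII-p2 g16), `--supports stmt-NavierStokesRegularity-19832 --as helper`.  Texts = nsreg-p2 g45's `r55/Sketch55.lean`
(sha16 556b38828be01d7e, namespace `NsregP2.R55.Pinch`) §0 + §K, VERBATIM with the idiom `simFlow ρ V′ s :=
ODE.evolutionMap (fun _ => selfSimilarTransport (1/(2+ρ)) 0 V′) 0 s` UNFOLDED (this file stays definition-free).

Setting (R52–R55): a `C²` self-similar Euler profile `(V, P)` with `γ = 1/(2+ρ)`, centre `0` (`IsSelfSimilarEulerProfile γ 0 V P`),
`Ω = curl V`, `W = γy + V`, and the lineage's cut-off similarity flow `Ψ_s` of `W′ = γy + V′` (`V′ ∈ C²`, `‖DV′‖ ≤ K`, `V′ = V` on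
`ball 0 Rbig`); backward time is `s = −σ`, `σ ≥ 0`.

CONTENTS (all PROVED, std axioms; proofs = Sketch55's, by nsreg-p2 g45):
* `inner_curl_gradient_comp_flow` — THE POINTWISE PINCH IDENTITY `⟪Ω(a), ∇(θ∘Ψ_{−σ})(a)⟫ = e^{−(1+γ)σ}⟪Ω, ∇θ⟫(Ψ_{−σ}a)`
  (chain rule + the tree's local Cauchy formula `NeedleClock.cauchy_formula_linger`);
* `integral_comp_flow_neg_eq` — THE SIGNED BACKWARD LIOUVILLE change of variables `∫_T g∘Ψ_{−σ} = e^{3γσ}∫_{Ψ_{−σ}T} g`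
  (Mathlib's area formula + the tree's `BernoulliLandscape.det_fderiv_flow_eq_exp_of_stay`);
* **K1** `kelvinTransportIdentity (hρ : 2 + ρ ≠ 0) V : <NsregP2.R55.Pinch.KelvinTransportIdentity ρ V unfolded>` —
  `∫_T ⟪Ω, ∇(θ∘Ψ_{−σ})⟫ = e^{−ργσ} ∫_{Ψ_{−σ}T} ⟪Ω, ∇θ⟫`; rate lemma `cauchy_plus_liouville_rate` (`−(1+γ)+3γ = −ργ`).
Part 2 (`…KelvinPinch.lean`) carries MASS / K2 / K3.

HONEST FRAMING: Lagrangian bookkeeping for HYPOTHETICAL profiles (CIV 2026's self-similar Kelvin/Cauchy law in set-wise backward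
form); nothing here bears on the crux E (19832, OPEN) or on NS regularity; «hard core evaded: NO».
[nsreg-p2 R55 §K t60-PINCH; cite: ConstantinIgnatovaVicol2026Putative, §3.4.1 eq. (3.22)–(3.24), §3.4.2]
-/

noncomputable section

set_option linter.dupNamespace false

open Filter Topology MeasureTheory Set Metric Function InnerProductSpace
open scoped RealInnerProductSpace ENNReal NNReal

namespace Summit.NavierStokesRegularity.NavierStokesRegularity.Theorems.PowerGaugeEulerLiouville.KelvinPinch

open Literature.Analysis Literature.Analysis.FluidPDE
open Summit.NavierStokesRegularity.NavierStokesRegularity.Theorems.PowerGaugeEulerLiouville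

/-- **THE POINTWISE PINCH IDENTITY (PROVED from the tree's LOCAL CAUCHY FORMULA `NeedleClock.cauchy_formula_linger`).**
For a label `a` whose backward history on `[0, σ]` stays in `ball 0 R ⊆ ball 0 Rbig` and a `C¹` observable `θ`:
`⟪Ω(a), ∇(θ∘Ψ_{−σ})(a)⟫ = e^{−(1+γ)σ} ⟪Ω(Ψ_{−σ}a), ∇θ(Ψ_{−σ}a)⟫` — the chain rule `∇(θ∘Ψ) = DΨᵀ(∇θ∘Ψ)` moves `DΨ_{−σ}(a)`
onto `Ω(a)`, and `DΨ_{−σ}(a)Ω(a) = e^{−(1+γ)σ}Ω(Ψ_{−σ}a)` is the Cauchy formula.  K1 is this identity integrated over `T`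
against the backward Liouville Jacobian `e^{3γσ}`: `e^{(3γ−1−γ)σ} = e^{(2γ−1)σ} = e^{−ργσ}`.
(= Sketch55 `inner_curl_gradient_comp_simFlow`, `simFlow` unfolded.)
[nsreg-p2 R55 §K PW; cite: ConstantinIgnatovaVicol2026Putative, §3.4.1 eq. (3.23)–(3.24)] -/
theorem inner_curl_gradient_comp_flow {ρ : ℝ} {V : EuclideanSpace ℝ (Fin 3) → EuclideanSpace ℝ (Fin 3)}
    {P : EuclideanSpace ℝ (Fin 3) → ℝ} (hP : IsSelfSimilarEulerProfile (1 / (2 + ρ)) 0 V P)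
    {V' : EuclideanSpace ℝ (Fin 3) → EuclideanSpace ℝ (Fin 3)} (hV' : ContDiff ℝ 2 V') {K : ℝ}
    (hK : ∀ y, ‖fderiv ℝ V' y‖ ≤ K) {R Rbig : ℝ} (hRbig : R < Rbig)
    (hVeq : ∀ w ∈ ball (0 : EuclideanSpace ℝ (Fin 3)) Rbig, V' w = V w) {θ : EuclideanSpace ℝ (Fin 3) → ℝ}
    (hθ : ContDiff ℝ 1 θ) {σ : ℝ} (hσ : 0 ≤ σ) {a : EuclideanSpace ℝ (Fin 3)}
    (ha : ∀ σ' ∈ Icc 0 σ,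
      ODE.evolutionMap (fun _ : ℝ => selfSimilarTransport (1 / (2 + ρ)) (0 : EuclideanSpace ℝ (Fin 3)) V') 0 (-σ') a ∈
        ball (0 : EuclideanSpace ℝ (Fin 3)) R) :
    ⟪curl V a, gradient (fun b => θ
        (ODE.evolutionMap (fun _ : ℝ => selfSimilarTransport (1 / (2 + ρ)) (0 : EuclideanSpace ℝ (Fin 3)) V') 0 (-σ) b)) a⟫ =
      Real.exp (-((1 + 1 / (2 + ρ)) * σ)) *
        ⟪curl V (ODE.evolutionMap (fun _ : ℝ => selfSimilarTransport (1 / (2 + ρ)) (0 : EuclideanSpace ℝ (Fin 3)) V') 0 (-σ) a),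
          gradient θ
            (ODE.evolutionMap (fun _ : ℝ => selfSimilarTransport (1 / (2 + ρ)) (0 : EuclideanSpace ℝ (Fin 3)) V') 0 (-σ) a)⟫ := by
  have hy : ∀ σ' ∈ Icc (0 : ℝ) σ,
      ‖ODE.evolutionMap (fun _ : ℝ => selfSimilarTransport (1 / (2 + ρ)) (0 : EuclideanSpace ℝ (Fin 3)) V') 0 (-σ') a‖ ≤ R :=
    fun σ' hσ' => (mem_ball_zero_iff.1 (ha σ' hσ')).le
  set Ψ := ODE.evolutionMap (fun _ : ℝ => selfSimilarTransport (1 / (2 + ρ)) (0 : EuclideanSpace ℝ (Fin 3)) V') 0 (-σ)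
    with hΨ
  have hΨd : DifferentiableAt ℝ Ψ a :=
    ((C2.Kelvin.contDiff_flow (γ := 1 / (2 + ρ)) hV' hK (-σ)).differentiable (by norm_num)) a
  have hθd : DifferentiableAt ℝ θ (Ψ a) := (hθ.differentiable one_ne_zero) _
  have hcomp : HasFDerivAt (fun b => θ (Ψ b)) ((fderiv ℝ θ (Ψ a)).comp (fderiv ℝ Ψ a)) a :=
    hθd.hasFDerivAt.comp a hΨd.hasFDerivAt
  have hC : fderiv ℝ Ψ a (curl V a) = Real.exp (-((1 + 1 / (2 + ρ)) * σ)) • curl V (Ψ a) :=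
    NeedleClock.cauchy_formula_linger hP hV' hK hRbig hVeq hy σ ⟨hσ, le_rfl⟩
  -- `⟪v, ∇f(x)⟫ = Df(x) v` (the tree's `EulerReynoldsLadder.inner_gradient_eq_fderiv`, inlined to keep the import closure small)
  have ig : ∀ (f : EuclideanSpace ℝ (Fin 3) → ℝ) (x v : EuclideanSpace ℝ (Fin 3)), ⟪v, gradient f x⟫ = fderiv ℝ f x v :=
    fun f x v => by rw [real_inner_comm, gradient, InnerProductSpace.toDual_symm_apply]
  rw [ig, hcomp.fderiv, ContinuousLinearMap.comp_apply, hC, map_smul, smul_eq_mul, ig]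

/-- **THE SIGNED BACKWARD LIOUVILLE CHANGE OF VARIABLES (PROVED; Bochner form of the tree's `Loc.lintegral_comp_backwardFlow_eq_of_stay`).**
If every label of the measurable set `T` has backward history in `ball 0 R ⊆ ball 0 Rbig` on `[0, σ]`, then for every `g`:
`∫_T g(Ψ_{−σ} a) da = e^{3γσ} ∫_{Ψ_{−σ}T} g` (area formula for `Φ_σ` on `S := Ψ_{−σ}T = Φ_σ⁻¹T` with `det DΦ_σ ≡ e^{3γσ}` there,
`BernoulliLandscape.det_fderiv_flow_eq_exp_of_stay`, the cut-off being divergence-free on `B̄_R` because `V′ = V` there).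
(= Sketch55 `integral_comp_simFlow_neg_eq`, `simFlow` unfolded.)
[nsreg-p2 R55 §K SL; cite: ConstantinIgnatovaVicol2026Putative, §3.4.1 eq. (3.22)] -/
theorem integral_comp_flow_neg_eq {ρ : ℝ} {V : EuclideanSpace ℝ (Fin 3) → EuclideanSpace ℝ (Fin 3)}
    {P : EuclideanSpace ℝ (Fin 3) → ℝ} (hP : IsSelfSimilarEulerProfile (1 / (2 + ρ)) 0 V P)
    {V' : EuclideanSpace ℝ (Fin 3) → EuclideanSpace ℝ (Fin 3)} (hV' : ContDiff ℝ 2 V') {K : ℝ}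
    (hK : ∀ y, ‖fderiv ℝ V' y‖ ≤ K) {R Rbig : ℝ} (hRbig : R < Rbig)
    (hVeq : ∀ w ∈ ball (0 : EuclideanSpace ℝ (Fin 3)) Rbig, V' w = V w) {T : Set (EuclideanSpace ℝ (Fin 3))}
    (hT : MeasurableSet T) {σ : ℝ} (hσ : 0 ≤ σ)
    (hhist : ∀ a ∈ T, ∀ σ' ∈ Icc 0 σ,
      ODE.evolutionMap (fun _ : ℝ => selfSimilarTransport (1 / (2 + ρ)) (0 : EuclideanSpace ℝ (Fin 3)) V') 0 (-σ') a ∈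
        ball (0 : EuclideanSpace ℝ (Fin 3)) R)
    (g : EuclideanSpace ℝ (Fin 3) → ℝ) :
    ∫ a in T, g (ODE.evolutionMap (fun _ : ℝ => selfSimilarTransport (1 / (2 + ρ)) (0 : EuclideanSpace ℝ (Fin 3)) V') 0 (-σ) a) =
      Real.exp (3 * (1 / (2 + ρ)) * σ) *
        ∫ z in ODE.evolutionMap (fun _ : ℝ => selfSimilarTransport (1 / (2 + ρ)) (0 : EuclideanSpace ℝ (Fin 3)) V') 0 (-σ) '' T,
          g z := by
  set γ : ℝ := 1 / (2 + ρ) with hγ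
  set Φ := ODE.evolutionMap (fun _ : ℝ => selfSimilarTransport γ (0 : EuclideanSpace ℝ (Fin 3)) V') 0 with hΦ
  have hV'1 : ContDiff ℝ 1 V' := hV'.of_le (by norm_num)
  -- the cut-off is divergence free on `‖z‖ ≤ R`
  have hdiv : ∀ z : EuclideanSpace ℝ (Fin 3), ‖z‖ ≤ R → VectorCalculus.divergence V' z = 0 := by
    intro z hz
    have hzb : z ∈ ball (0 : EuclideanSpace ℝ (Fin 3)) Rbig := mem_ball_zero_iff.2 (lt_of_le_of_lt hz hRbig)
    have hfd : fderiv ℝ V' z = fderiv ℝ V z := NeedleClock.fderiv_eq_of_agree_ball hVeq hzb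
    have h := hP.divFree z
    simp only [VectorCalculus.divergence] at h ⊢
    rw [hfd]; exact h
  have hflow_add : ∀ (s s' : ℝ) (y : EuclideanSpace ℝ (Fin 3)), Φ (s + s') y = Φ s (Φ s' y) :=
    fun s s' y => C2.Kelvin.flow_add (γ := γ) hV'1 hK s s' y
  have hΦinv : ∀ y, Φ σ (Φ (-σ) y) = y := by
    intro y
    have h1 := hflow_add σ (-σ) y
    rw [add_neg_cancel] at h1
    rw [← h1]; exact ODE.evolutionMap_self _ 0 y
  have hΦinv' : ∀ z, Φ (-σ) (Φ σ z) = z := by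
    intro z
    have h1 := hflow_add (-σ) σ z
    rw [neg_add_cancel] at h1
    rw [← h1]; exact ODE.evolutionMap_self _ 0 z
  set S : Set (EuclideanSpace ℝ (Fin 3)) := Φ σ ⁻¹' T with hS
  have hΦσc : Continuous (Φ σ) := (C2.Kelvin.contDiff_flow (γ := γ) hV' hK σ).continuous
  have hSm : MeasurableSet S := hΦσc.measurable hT
  have himage : Φ σ '' S = T := by
    ext y
    constructor
    · rintro ⟨z, hz, rfl⟩; exact hz
    · intro hy; exact ⟨Φ (-σ) y, by show Φ σ (Φ (-σ) y) ∈ T; rw [hΦinv y]; exact hy, hΦinv y⟩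
  have himage' : Φ (-σ) '' T = S := by
    ext z
    constructor
    · rintro ⟨y, hy, rfl⟩; show Φ σ (Φ (-σ) y) ∈ T; rw [hΦinv y]; exact hy
    · intro hz; exact ⟨Φ σ z, hz, hΦinv' z⟩
  have hL := C2.Kelvin.isUniformlyLipschitzOn_transport (γ := γ) hV'1 hK
  have hdiff : ∀ x ∈ S, HasFDerivWithinAt (Φ σ) (fderiv ℝ (Φ σ) x) S x := fun x _ =>
    (((C2.Kelvin.contDiff_flow (γ := γ) hV' hK σ).differentiable (by norm_num)) x).hasFDerivAt.hasFDerivWithinAt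
  have hinj : InjOn (Φ σ) S := (hL.bijective_evolutionMap convex_univ (mem_univ _) (mem_univ _)).injective.injOn
  -- forward orbits from `S` stay in the closed ball on `[0, σ]`
  have hstayS : ∀ z ∈ S, ∀ s ∈ Icc 0 σ, ‖Φ s z‖ ≤ R := by
    intro z hz s hs
    have h1 : Φ s z = Φ (-(σ - s)) (Φ σ z) := by
      rw [← hflow_add (-(σ - s)) σ z]; congr 1; ring
    rw [h1]
    exact (mem_ball_zero_iff.1 (hhist (Φ σ z) hz (σ - s) ⟨by linarith [hs.2], by linarith [hs.1]⟩)).le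
  have hdet : ∀ z ∈ S, |(fderiv ℝ (Φ σ) z).det| = Real.exp (3 * γ * σ) := by
    intro z hz
    rw [BernoulliLandscape.det_fderiv_flow_eq_exp_of_stay (γ := γ) hV' hK hσ hdiv z (hstayS z hz),
      abs_of_pos (Real.exp_pos _)]
  calc ∫ a in T, g (Φ (-σ) a) = ∫ a in Φ σ '' S, g (Φ (-σ) a) := by rw [himage]
    _ = ∫ z in S, |(fderiv ℝ (Φ σ) z).det| • g (Φ (-σ) (Φ σ z)) :=
        integral_image_eq_integral_abs_det_fderiv_smul volume hSm hdiff hinj _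
    _ = ∫ z in S, Real.exp (3 * γ * σ) * g z := by
        refine setIntegral_congr_fun hSm (fun z hz => ?_)
        simp only [smul_eq_mul]
        rw [hdet z hz, hΦinv' z]
    _ = Real.exp (3 * γ * σ) * ∫ z in Φ (-σ) '' T, g z := by rw [integral_const_mul, himage']

/-- **K1 PROVED: THE KELVIN TRANSPORT IDENTITY** (text = `NsregP2.R55.Pinch.KelvinTransportIdentity ρ V` of `r55/Sketch55.lean`
556b38828be01d7e, Seed55 VERBATIM, with `simFlow` unfolded) = the pointwise pinch identity integrated over `T` with the signed backward
Liouville change of variables; rate `e^{−(1+γ)σ}·e^{3γσ} = e^{(2γ−1)σ} = e^{−ρσ/(2+ρ)}` (theorem-level guard `2 + ρ ≠ 0`).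
For every measurable label set `T` whose backward history up to `σ ≥ 0` stays in `ball 0 R` (`R < Rbig`) and every `C¹` observable `θ`:
`∫_T ⟪curl V, ∇(θ∘Ψ_{−σ})⟫ = e^{−ρσ/(2+ρ)} ∫_{Ψ_{−σ}T} ⟪curl V, ∇θ⟫`.
By-name check: `example {ρ} (hρ : 2 + ρ ≠ 0) (V) : NsregP2.R55.Pinch.KelvinTransportIdentity ρ V := kelvinTransportIdentity hρ V`.
[nsreg-p2 R55 §K K1; cite: ConstantinIgnatovaVicol2026Putative, §3.4.1 eq. (3.22)–(3.24), §3.4.2] -/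
theorem kelvinTransportIdentity {ρ : ℝ} (hρ : 2 + ρ ≠ 0) (V : EuclideanSpace ℝ (Fin 3) → EuclideanSpace ℝ (Fin 3)) :
    ∀ P : EuclideanSpace ℝ (Fin 3) → ℝ, IsSelfSimilarEulerProfile (1 / (2 + ρ)) 0 V P →
    ∀ (T : Set (EuclideanSpace ℝ (Fin 3))) (σ R : ℝ) (V' : EuclideanSpace ℝ (Fin 3) → EuclideanSpace ℝ (Fin 3))
      (K Rbig : ℝ) (θ : EuclideanSpace ℝ (Fin 3) → ℝ),
      MeasurableSet T → 0 ≤ σ → 0 < R → ContDiff ℝ 2 V' → (∀ y, ‖fderiv ℝ V' y‖ ≤ K) → R < Rbig →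
      (∀ w ∈ ball (0 : EuclideanSpace ℝ (Fin 3)) Rbig, V' w = V w) →
      (∀ a ∈ T, ∀ σ' ∈ Icc 0 σ,
        ODE.evolutionMap (fun _ : ℝ => selfSimilarTransport (1 / (2 + ρ)) (0 : EuclideanSpace ℝ (Fin 3)) V') 0 (-σ') a ∈
          ball (0 : EuclideanSpace ℝ (Fin 3)) R) →
      ContDiff ℝ 1 θ →
      ∫ a in T, ⟪curl V a, gradient (fun b => θ
          (ODE.evolutionMap (fun _ : ℝ => selfSimilarTransport (1 / (2 + ρ)) (0 : EuclideanSpace ℝ (Fin 3)) V') 0 (-σ) b)) a⟫ =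
        Real.exp (-(ρ / (2 + ρ) * σ)) *
          ∫ y in ODE.evolutionMap (fun _ : ℝ => selfSimilarTransport (1 / (2 + ρ)) (0 : EuclideanSpace ℝ (Fin 3)) V') 0 (-σ) '' T,
            ⟪curl V y, gradient θ y⟫ := by
  intro P hP T σ R V' K Rbig θ hT hσ _hR hV' hK hRbig hVeq hhist hθ
  have hpt : ∀ a ∈ T, ⟪curl V a, gradient (fun b => θ
      (ODE.evolutionMap (fun _ : ℝ => selfSimilarTransport (1 / (2 + ρ)) (0 : EuclideanSpace ℝ (Fin 3)) V') 0 (-σ) b)) a⟫ =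
      Real.exp (-((1 + 1 / (2 + ρ)) * σ)) *
        ⟪curl V (ODE.evolutionMap (fun _ : ℝ => selfSimilarTransport (1 / (2 + ρ)) (0 : EuclideanSpace ℝ (Fin 3)) V') 0 (-σ) a),
          gradient θ
            (ODE.evolutionMap (fun _ : ℝ => selfSimilarTransport (1 / (2 + ρ)) (0 : EuclideanSpace ℝ (Fin 3)) V') 0 (-σ) a)⟫ :=
    fun a ha => inner_curl_gradient_comp_flow hP hV' hK hRbig hVeq hθ hσ (hhist a ha)
  rw [setIntegral_congr_fun hT hpt, integral_const_mul,
    integral_comp_flow_neg_eq hP hV' hK hRbig hVeq hT hσ hhist (fun z => ⟪curl V z, gradient θ z⟫), ← mul_assoc,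
    ← Real.exp_add]
  congr 2
  field_simp
  ring

/-- The K1 rate: pointwise Cauchy damping `−(1+γ)` plus backward Liouville `+3γ` is `2γ − 1 = −ρ/(2+ρ) = −ργ`.
[nsreg-p2 R55 §K EXP] -/
theorem cauchy_plus_liouville_rate {ρ : ℝ} (hρ : 2 + ρ ≠ 0) :
    -(1 + 1 / (2 + ρ)) + 3 * (1 / (2 + ρ)) = -(ρ / (2 + ρ)) := by
  field_simp; ring

end Summit.NavierStokesRegularity.NavierStokesRegularity.Theorems.PowerGaugeEulerLiouville.KelvinPinch

end
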